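/-
Copyright (c) 2026 the pub-hodgecm-mathlib formalisation cell (harness21).  Prover seat hodgecm-mathlib-R90-C133-p03 (g3), Track B ∕ K2-LIT ∕ R90-TF section S5
(Rogawski Ch. 13.3 ∕ §14.6); CENSUS-OccG §5 ∕ RULING S5-R16 (6): the Theorems-side CORE of D ED. 5's `archRow_h1336c_of_record` — kit-generic, socket as a hypothesis.
-/
import Summits.HodgeConjecture.HodgeConjecture.Theorems.R90S5SpectralPacketHOfOneDim      -- ★ p862138 `IsOneDimH` (+ ★ 3g `SpectralPacketH`, ★ 3a `SpectralPacketG`, ★ FILE 1∕2 kit ∕ `GlobalPacket(H)`, ★ `IsCharPacket`)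
import Summits.HodgeConjecture.HodgeConjecture.Theorems.R90S2ArchKitDefs                 -- ★ S2 `R90.S2.qsFrame`, `qsFrame_spec L ι` (the CLOSED frame of `Φ₃` at `ι`); brings ★ `archDegOneClass`, `IsCohUnitaryIrrep`, `splitForm`
import Literature.NumberTheory.Automorphic.DiscreteAutomorphicRepArchModuleCM             -- ★ `DiscreteAutomorphicRep.archModuleCM ι T hT` (+ `archRepKCM`, `archRepLieCM`)
import HarnessLib

/-!
# R90-TF · S5 — `R90S5ArchRowOfQsArchSocket`: THE ROW `h1336cArch` OF ★ p864086 FROM THE KIT-LEVEL ARCH-TRIGGER SOCKET — «a discrete `P′` of `U(Φ₃)` with a coh-unitary token of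
# class `[J^δ]` at `ι` lies in an A-packet `Π(ξ′)`» ⟹ «its finite family lies placewise in `ξ_H` of a CHARACTER packet» (Rogawski 1990, Thm. 13.3.6 (c) p. 202 at the real place;
# §12.3 p. 178; §13.3 p. 201 ll. 16–18)

Cell `hodgecm-mathlib`, crux H413 (`stmt-HodgeConjecture-24833`), route of record `HCCMUnconditional`; programme R90-TF, section S5 (Rogawski Ch. 13.3); RULING S5-R16 (6) of
the S5 dealer R90-C133-plan (g3) 2026-09-05T01:48:39Z («D ED. 5 = … + socket `SocketQsArchTriggerMembership` (kit-level) + the PROVED theorem `archRow_h1336c_of_record` = ★ p864086's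
`h1336cArch` at `Occ := OccGOfRecord L ι μ`, ≤ 10 lines over the stub»), CENSUS-OccG §3∕§5 (14d3a58b71e65a35), hand R90-C133-p03 (g3).  THEOREMS ONLY (`--kind proof --supports
stmt-HodgeConjecture-24833 --as helper`): no `def`, no instance (the `attribute [local instance 100] LieRing.ofAssociativeRing` line is the Mathlib idiom of ★ `GlobalAPacketLetters`
∕ A ∕ 226 ★ Theorems files), no notation, no named fact, no `sorry`, NO `Lines` import; reads no archimedean packet slot (LAW NO-INF).

WHAT.  The (β)-core ★ p864086 `R90S5ArchJExhaustionCoreOcc` is parametric in an occurrence predicate `Occ` with ONE axiom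
`h1336cArch : ∀ π, Occ π j → ∃ σ : GlobalPacketH 𝔩, (∃ ξ′, σ.IsCharPacket (ξ′-chars)) ∧ ∀ v, π v ∈ (𝔩 v).mem ((𝔩 v).xiH (σ.loc v))` [Thm. 13.3.6 (c) at `ι`].  At the record
(`Occ := OccGOfRecord L ι μ`, ★-cand `R90S5OccGOfRecord`, (RB2) `exists_rep`) an `Occ`-witness is a discrete `P′` of `U(Φ₃)` whose D6-constituents are EXACTLY `π` and which carries
a coh-unitary `(𝔤, K)`-token of class `j = archDegOneClass δ hδ` at the closed frame ★ `R90.S2.qsFrame`.  D ED. 5's socket `SocketQsArchTriggerMembership` (kit-level, S5-R16 (6))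
sends such a `P′` to an A-packet: a spectral `G`-packet `Q` and a ONE-DIMENSIONAL spectral `H`-packet `ρ` (★ p862138 `IsOneDimH ρ`: `ρ.fin` is a character packet) with `Q_v = ξ_H(ρ_v)`
at every place and every D6-constituent of `P′` a member of `Q_v`.  THIS FILE proves the row from the socket TAKEN AS A HYPOTHESIS `hsock` in the generic currency of ★ 3a∕3g
(`SpectralPacketG 𝔩 𝔞 μ` ∕ `SpectralPacketH 𝔩 𝔞 𝔞H DiscH`, C2's `PacketGOfRecord = HomogPacketG …` enters through `.1`, `MemOfRecord (mk P′) Pk` instantiated at the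
representative `P′`, `LiftsToOfRecord` unfolded) — so that D ED. 5's `archRow_h1336c_of_record` is a THREE-LINE adapter `… (fun P′ … => ⟨Pk.1, ξH, h1, hl, fun v c′ hc => hm P′ rfl v c′ hc⟩)`
and ★ p864086 ∕ p01's (H10) (T2) get their `h1336cArch` BY NAME.  §1 states it over the (RB2) OUTPUT shape (a representative `P′` with `↔`-pinned constituents + token), hence
imports neither `R90S5OccGOfRecord` nor any Lines file; §2 is the `∀ π, ‹∃ P′ …› → …` packaging = `h1336cArch`'s binder shape once `Occ π j` is unfolded by (RB2).
HONEST LABEL: bookkeeping around a socket (Thm. 13.3.6 (c) at the real place is the HYPOTHESIS `hsock`, S5's own residual row, payer D ED. 6 `qsArchMembership_of_sections` over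
★ p864011 + S10-F's `hPin_nArch`); proves no trace-formula statement; REL ≠ ★ ≠ BUILT; HC_CM is proved only modulo the 7 printed citations (2 remaining named inputs: hLiu418 =
stmt-HodgeConjecture-24832, h413 = stmt-HodgeConjecture-24833) until rung 0 closes.

## References
* [Rogawski1990] J. D. Rogawski, *Automorphic Representations of Unitary Groups in Three Variables*, Ann. of Math. Stud. 123 (1990), §12.3 p. 178; §13.1 p. 199 ¶2; §13.3 p. 201
  ll. 16–18, Thm. 13.3.6 (c) p. 202, p. 203; §13.10 pp. 230–231.
* [FlathCorvallis1979] D. Flath, *Decomposition of representations into tensor products*, Proc. Sympos. Pure Math. 33.1 (1979), Thm. 3.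
-/

set_option autoImplicit false
set_option linter.dupNamespace false -- the mandated namespace repeats `HodgeConjecture.HodgeConjecture`, as in every sibling `R90S5*` file

-- Mathlib idiom (as in A ∕ ★ `GlobalAPacketLetters` ∕ ★ `F0P3ArchTokenUnitary`): the commutator bracket on `Module.End ℂ M`.
attribute [local instance 100] LieRing.ofAssociativeRing

noncomputable section

open NumberField IsDedekindDomain MeasureTheory Filter
open scoped Matrix
open Literature.NumberTheory Literature.NumberTheory.Automorphic Literature.NumberTheory.Automorphic.UnitaryGroup
open Literature.NumberTheory.Rogawski1990 Literature.NumberTheory.GaloisRepresentations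
open Literature.RepresentationTheory Literature.RepresentationTheory.BorelWallach2000 Literature.RepresentationTheory.KonnoKonno2007

namespace Summit.HodgeConjecture.HodgeConjecture.R90.S5

open Summit.HodgeConjecture.HodgeConjecture.Cruxes.H413
open Summit.HodgeConjecture.HodgeConjecture.Cruxes.H413.F0P3LocalPacketKit
open Summit.HodgeConjecture.HodgeConjecture.Cruxes.H413.F0P3GlobalPacket
open Summit.HodgeConjecture.HodgeConjecture.Cruxes.H413.F0P3ArchPacketKit
open Summit.HodgeConjecture.HodgeConjecture.Cruxes.H413.F0P3SpectralPacket
open Summit.HodgeConjecture.HodgeConjecture.Cruxes.H413.F0P3InnerFormClassificationV6 (splitForm)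
open Summit.HodgeConjecture.HodgeConjecture.Cruxes.H413.F0P3bArchDegOnePackage (IsCohUnitaryIrrep)
open Summit.HodgeConjecture.HodgeConjecture.Cruxes.H413.F0P3bArchDegOneClass (archDegOneClass)

variable (L : Type) [Field L] [NumberField L] [IsCMField L] (ι : L →+* ℂ)
  {𝔩 : ∀ v : HeightOneSpectrum (𝓞 ↥(maximalRealSubfield L)), LocalPacketKit L (splitForm L 3) v} {𝔞 : ArchPacketKit} {𝔞H : ArchPacketKitH 𝔞}
  {DiscH : GlobalPacketH 𝔩 → 𝔞H.PktInfH → Prop}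
  (μ : Measure (adelicGroupData (↥(maximalRealSubfield L)) L (IsCMField.complexConj L) 3 (splitForm L 3)).automorphicQuotient)
  [(adelicGroupData (↥(maximalRealSubfield L)) L (IsCMField.complexConj L) 3 (splitForm L 3)).IsAutomorphicMeasure μ]
  (δ : ℤ) (hδ : δ = 1 ∨ δ = -1)
  -- THE KIT-LEVEL ARCH-TRIGGER SOCKET (D ED. 5 `SocketQsArchTriggerMembership`, C2 bodies unfolded): Thm. 13.3.6 (c) at the real place ι, as a HYPOTHESIS
  (hsock : ∀ (P' : DiscreteAutomorphicRep (adelicGroupData (↥(maximalRealSubfield L)) L (IsCMField.complexConj L) 3 (splitForm L 3)) μ)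
    (M : Type) [AddCommGroup M] [Module ℂ M] (σK : Representation ℂ (uFormGroup (Fin 2) (Fin 1)).maximalCompact M)
    (σ𝔤 : (uFormGroup (Fin 2) (Fin 1)).lie →ₗ⁅ℝ⁆ Module.End ℂ M) (hM : IsCohUnitaryIrrep σK σ𝔤),
    (∃ T₁ : P'.archModuleCM ι R90.S2.qsFrame (R90.S2.qsFrame_spec L ι) →ₗ[ℂ] M,
      (∀ (k : (uFormGroup (Fin 2) (Fin 1)).maximalCompact) (w : P'.archModuleCM ι R90.S2.qsFrame (R90.S2.qsFrame_spec L ι)),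
          T₁ (P'.archRepKCM ι R90.S2.qsFrame (R90.S2.qsFrame_spec L ι) k w) = σK k (T₁ w)) ∧
        (∀ (X : (uFormGroup (Fin 2) (Fin 1)).lie) (w : P'.archModuleCM ι R90.S2.qsFrame (R90.S2.qsFrame_spec L ι)),
          T₁ (P'.archRepLieCM ι R90.S2.qsFrame (R90.S2.qsFrame_spec L ι) X w) = σ𝔤 X (T₁ w)) ∧ T₁ ≠ 0) →
    GKIrrClass.ofModule M σK σ𝔤 hM.gk hM.irred = archDegOneClass δ hδ →
    ∃ (Q : SpectralPacketG 𝔩 𝔞 μ) (ρ : SpectralPacketH 𝔩 𝔞 𝔞H DiscH), IsOneDimH ρ ∧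
      (∀ v : HeightOneSpectrum (𝓞 ↥(maximalRealSubfield L)), Q.fin.loc v = (𝔩 v).xiH (ρ.fin.loc v)) ∧
      ∀ (v : HeightOneSpectrum (𝓞 ↥(maximalRealSubfield L))) (c' : IrrClass ((cmDatum L 3 (splitForm L 3)).Local v)),
        (IrrClass.comap (localPiEquiv L (IsCMField.complexConj L) 3 (splitForm L 3) v) c').IsConstituentOf
            (P'.finRep.smoothPart.toRepresentation.comp (inclPlace (↥(maximalRealSubfield L)) L (IsCMField.complexConj L) 3 (splitForm L 3) v)) →
          c' ∈ (𝔩 v).mem (Q.fin.loc v))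

include hsock

/-! ## §1 From a representative: the arch-trigger socket puts the constituent family into `ξ_H` of a character packet [Thm. 13.3.6 (c) at ι; p. 201 ll. 16–18] -/

/-- **THE ROW FROM THE SOCKET, AT A REPRESENTATIVE `P′`**: if the finite family `π` is EXACTLY the family of D6-constituents of a discrete `P′` of `U(Φ₃)` (`↔`-clause = (RB2) of
★-cand `R90S5OccGOfRecord`) carrying a coh-unitary token of class `[J^δ]` at `ι` (A's `htok`∕`hcls` text at the closed frame ★ `R90.S2.qsFrame`), then `π_v ∈ ξ_H(σ_v)` at every
finite place for a CHARACTER packet family `σ` (namely `σ := ρ.fin` for the socket's one-dimensional `ρ`, ★ `IsOneDimH` unfolded).  [cite: Rogawski1990, §13.3 Thm. 13.3.6 (c) p. 202,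
p. 201 ll. 16–18; §12.3 p. 178] [cite: FlathCorvallis1979, Thm. 3] -/
theorem exists_charPacket_mem_xiH_of_rep_of_token
    (π : ∀ v : HeightOneSpectrum (𝓞 ↥(maximalRealSubfield L)), IrrClass ((cmDatum L 3 (splitForm L 3)).Local v))
    (P' : DiscreteAutomorphicRep (adelicGroupData (↥(maximalRealSubfield L)) L (IsCMField.complexConj L) 3 (splitForm L 3)) μ)
    (hrel : ∀ (v : HeightOneSpectrum (𝓞 ↥(maximalRealSubfield L))) (c' : IrrClass ((cmDatum L 3 (splitForm L 3)).Local v)),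
      (IrrClass.comap (localPiEquiv L (IsCMField.complexConj L) 3 (splitForm L 3) v) c').IsConstituentOf
          (P'.finRep.smoothPart.toRepresentation.comp (inclPlace (↥(maximalRealSubfield L)) L (IsCMField.complexConj L) 3 (splitForm L 3) v)) ↔ c' = π v)
    (M : Type) [AddCommGroup M] [Module ℂ M] (σK : Representation ℂ (uFormGroup (Fin 2) (Fin 1)).maximalCompact M)
    (σ𝔤 : (uFormGroup (Fin 2) (Fin 1)).lie →ₗ⁅ℝ⁆ Module.End ℂ M) (hM : IsCohUnitaryIrrep σK σ𝔤)
    (htok : ∃ T₁ : P'.archModuleCM ι R90.S2.qsFrame (R90.S2.qsFrame_spec L ι) →ₗ[ℂ] M,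
      (∀ (k : (uFormGroup (Fin 2) (Fin 1)).maximalCompact) (w : P'.archModuleCM ι R90.S2.qsFrame (R90.S2.qsFrame_spec L ι)),
          T₁ (P'.archRepKCM ι R90.S2.qsFrame (R90.S2.qsFrame_spec L ι) k w) = σK k (T₁ w)) ∧
        (∀ (X : (uFormGroup (Fin 2) (Fin 1)).lie) (w : P'.archModuleCM ι R90.S2.qsFrame (R90.S2.qsFrame_spec L ι)),
          T₁ (P'.archRepLieCM ι R90.S2.qsFrame (R90.S2.qsFrame_spec L ι) X w) = σ𝔤 X (T₁ w)) ∧ T₁ ≠ 0)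
    (hcls : GKIrrClass.ofModule M σK σ𝔤 hM.gk hM.irred = archDegOneClass δ hδ) :
    ∃ σ : GlobalPacketH 𝔩,
      (∃ ξ' : OneDimAutRepH L, σ.IsCharPacket (fun v => ξ'.xiLocalChar v) (fun v => F0P3XiLocalCharOpenKernel.isOpen_ker_xiLocalChar L ξ' v)) ∧
      ∀ v : HeightOneSpectrum (𝓞 ↥(maximalRealSubfield L)), π v ∈ (𝔩 v).mem ((𝔩 v).xiH (σ.loc v)) := by
  obtain ⟨Q, ρ, h1, hlift, hmem⟩ := hsock P' M σK σ𝔤 hM htok hcls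
  refine ⟨ρ.fin, h1, fun v => ?_⟩
  rw [← hlift v]
  exact hmem v (π v) ((hrel v (π v)).2 rfl)

/-- **THE SAME WITH THE SOCKET'S SPECTRAL DATA EXPOSED** (for (H10) (T2)-style consumers that want the one-dimensional spectral `ρ` and the lifted `Q`, not only `σ = ρ.fin`).
[cite: Rogawski1990, §13.3 Thm. 13.3.6 (c) p. 202, p. 201 ll. 16–18] -/
theorem exists_spectral_liftsTo_mem_of_rep_of_token
    (π : ∀ v : HeightOneSpectrum (𝓞 ↥(maximalRealSubfield L)), IrrClass ((cmDatum L 3 (splitForm L 3)).Local v))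
    (P' : DiscreteAutomorphicRep (adelicGroupData (↥(maximalRealSubfield L)) L (IsCMField.complexConj L) 3 (splitForm L 3)) μ)
    (hrel : ∀ (v : HeightOneSpectrum (𝓞 ↥(maximalRealSubfield L))) (c' : IrrClass ((cmDatum L 3 (splitForm L 3)).Local v)),
      (IrrClass.comap (localPiEquiv L (IsCMField.complexConj L) 3 (splitForm L 3) v) c').IsConstituentOf
          (P'.finRep.smoothPart.toRepresentation.comp (inclPlace (↥(maximalRealSubfield L)) L (IsCMField.complexConj L) 3 (splitForm L 3) v)) ↔ c' = π v)
    (M : Type) [AddCommGroup M] [Module ℂ M] (σK : Representation ℂ (uFormGroup (Fin 2) (Fin 1)).maximalCompact M)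
    (σ𝔤 : (uFormGroup (Fin 2) (Fin 1)).lie →ₗ⁅ℝ⁆ Module.End ℂ M) (hM : IsCohUnitaryIrrep σK σ𝔤)
    (htok : ∃ T₁ : P'.archModuleCM ι R90.S2.qsFrame (R90.S2.qsFrame_spec L ι) →ₗ[ℂ] M,
      (∀ (k : (uFormGroup (Fin 2) (Fin 1)).maximalCompact) (w : P'.archModuleCM ι R90.S2.qsFrame (R90.S2.qsFrame_spec L ι)),
          T₁ (P'.archRepKCM ι R90.S2.qsFrame (R90.S2.qsFrame_spec L ι) k w) = σK k (T₁ w)) ∧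
        (∀ (X : (uFormGroup (Fin 2) (Fin 1)).lie) (w : P'.archModuleCM ι R90.S2.qsFrame (R90.S2.qsFrame_spec L ι)),
          T₁ (P'.archRepLieCM ι R90.S2.qsFrame (R90.S2.qsFrame_spec L ι) X w) = σ𝔤 X (T₁ w)) ∧ T₁ ≠ 0)
    (hcls : GKIrrClass.ofModule M σK σ𝔤 hM.gk hM.irred = archDegOneClass δ hδ) :
    ∃ (Q : SpectralPacketG 𝔩 𝔞 μ) (ρ : SpectralPacketH 𝔩 𝔞 𝔞H DiscH), IsOneDimH ρ ∧
      (∀ v : HeightOneSpectrum (𝓞 ↥(maximalRealSubfield L)), Q.fin.loc v = (𝔩 v).xiH (ρ.fin.loc v)) ∧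
      ∀ v : HeightOneSpectrum (𝓞 ↥(maximalRealSubfield L)), π v ∈ (𝔩 v).mem (Q.fin.loc v) := by
  obtain ⟨Q, ρ, h1, hlift, hmem⟩ := hsock P' M σK σ𝔤 hM htok hcls
  exact ⟨Q, ρ, h1, hlift, fun v => hmem v (π v) ((hrel v (π v)).2 rfl)⟩

/-! ## §2 The row `h1336cArch` of ★ p864086 in its binder shape (the `∃ P′` export unfolded, = (RB2) of `R90S5OccGOfRecord`) [Thm. 13.3.6 (c) at ι] -/

/-- **`h1336cArch` AT THE RECORD, FROM THE SOCKET**: for every finite family `π` that occurs through SOME discrete `P′` of `U(Φ₃)` with `↔`-pinned constituents and a coh-unitary token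
of class `[J^δ]` at `ι` (the (RB2)-unfolding of `OccGOfRecord L ι μ π (archDegOneClass δ hδ)`), `π` lies placewise in `ξ_H` of a character packet — the row ★ p864086
`ae_liftsTo_of_mem_occ` consumes at `Occ := OccGOfRecord L ι μ`, `j := archDegOneClass δ hδ` (D ED. 5's `archRow_h1336c_of_record` = this ∘ (RB2) ∘ the stub).
[cite: Rogawski1990, §13.3 Thm. 13.3.6 (c) p. 202; §12.3 p. 178; §15.3 ¶1 p. 249] -/
theorem archRow_h1336c_of_socket
    (π : ∀ v : HeightOneSpectrum (𝓞 ↥(maximalRealSubfield L)), IrrClass ((cmDatum L 3 (splitForm L 3)).Local v))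
    (hocc : ∃ P' : DiscreteAutomorphicRep (adelicGroupData (↥(maximalRealSubfield L)) L (IsCMField.complexConj L) 3 (splitForm L 3)) μ,
      (∀ (v : HeightOneSpectrum (𝓞 ↥(maximalRealSubfield L))) (c' : IrrClass ((cmDatum L 3 (splitForm L 3)).Local v)),
        (IrrClass.comap (localPiEquiv L (IsCMField.complexConj L) 3 (splitForm L 3) v) c').IsConstituentOf
            (P'.finRep.smoothPart.toRepresentation.comp (inclPlace (↥(maximalRealSubfield L)) L (IsCMField.complexConj L) 3 (splitForm L 3) v)) ↔ c' = π v) ∧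
      ∃ (M : Type) (_ : AddCommGroup M) (_ : Module ℂ M) (σK : Representation ℂ (uFormGroup (Fin 2) (Fin 1)).maximalCompact M)
        (σ𝔤 : (uFormGroup (Fin 2) (Fin 1)).lie →ₗ⁅ℝ⁆ Module.End ℂ M) (hM : IsCohUnitaryIrrep σK σ𝔤),
        (∃ T₁ : P'.archModuleCM ι R90.S2.qsFrame (R90.S2.qsFrame_spec L ι) →ₗ[ℂ] M,
          (∀ (k : (uFormGroup (Fin 2) (Fin 1)).maximalCompact) (w : P'.archModuleCM ι R90.S2.qsFrame (R90.S2.qsFrame_spec L ι)),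
              T₁ (P'.archRepKCM ι R90.S2.qsFrame (R90.S2.qsFrame_spec L ι) k w) = σK k (T₁ w)) ∧
            (∀ (X : (uFormGroup (Fin 2) (Fin 1)).lie) (w : P'.archModuleCM ι R90.S2.qsFrame (R90.S2.qsFrame_spec L ι)),
              T₁ (P'.archRepLieCM ι R90.S2.qsFrame (R90.S2.qsFrame_spec L ι) X w) = σ𝔤 X (T₁ w)) ∧ T₁ ≠ 0) ∧
        GKIrrClass.ofModule M σK σ𝔤 hM.gk hM.irred = archDegOneClass δ hδ) :
    ∃ σ : GlobalPacketH 𝔩,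
      (∃ ξ' : OneDimAutRepH L, σ.IsCharPacket (fun v => ξ'.xiLocalChar v) (fun v => F0P3XiLocalCharOpenKernel.isOpen_ker_xiLocalChar L ξ' v)) ∧
      ∀ v : HeightOneSpectrum (𝓞 ↥(maximalRealSubfield L)), π v ∈ (𝔩 v).mem ((𝔩 v).xiH (σ.loc v)) := by
  obtain ⟨P', hrel, M, _, _, σK, σ𝔤, hM, htok, hcls⟩ := hocc
  exact exists_charPacket_mem_xiH_of_rep_of_token L ι μ δ hδ hsock π P' hrel M σK σ𝔤 hM htok hcls

end Summit.HodgeConjecture.HodgeConjecture.R90.S5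

end
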